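import Mathlib
import Summits.Ventures.PercRepro2.Defs
import Summits.Ventures.PercRepro2.Independence
import Summits.Ventures.PercRepro2.Harris
import Summits.Ventures.PercRepro2.Graph
import Summits.Ventures.PercRepro2.Events
import Summits.Ventures.PercRepro2.BasePendant
import Summits.Ventures.PercRepro2.ZCPendantFirstOrder
import Summits.Ventures.PercRepro2.ZCPendantSecondOrder

/-!
# The root transfer at a pendant root: (ZC) with the leaf edge pinned open equals (ZC) on `G − a₁`
with root `x`; hence the row at a leaf root follows from the row on the graph with one vertex fewer
(blind cell PercRepro2, mine-a g30; MINE-A.md §84.2, §84.6)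

With the leaf edge `f = {a₁, x}` pinned open the root cluster is `insert a₁ (C(x))` computed with `f`
pinned closed (`cluster_update_true_eq_insert`), every connection `a₁ ↔ v` is `x ↔ v` in `G − a₁`
(`conn_leaf_open`), and the connections among the other vertices do not see `f`
(`conn_update_leaf_iff`).  Hence every probability of the (ZC) expression transfers:

  `Z(p[f ↦ 1]; root a₁; 𝓔; a₃, o) = Z(p[f ↦ 0]; root x; 𝓔'; a₃, o)`,  `𝓔' = {S ∣ insert a₁ S ∈ 𝓔}`

(`zc_pendant_transfer`), and with `zc_pendant_of_pinned_open`: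

  **`0 ≤ Z(p[f ↦ 0]; root x; 𝓔') → 0 ≤ Z(p; root a₁; 𝓔)`**   (`zc_pendant_of_root_x`)

— in the fixed-`(V, E)` vocabulary `p[f ↦ 0]` is percolation on `G − a₁` (the root isolated), so the
class of (graph, root) pairs on which row 2′ZC holds for every up-set is closed under attaching the
root as a leaf.  No definition; one seat.
-/

namespace Summit.Ventures.PercRepro2

namespace ZCPendant

section Transfer

variable {V : Type*} {E : Type*} [DecidableEq E] {ends : E → Sym2 V} {a₁ x : V} {f : E}

/-- With the leaf edge forced open, the root's cluster is the leaf together with the cluster of `x`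
computed with the leaf edge forced closed. -/
lemma cluster_update_true_eq_insert (hf : ends f = s(a₁, x)) (hleaf : ∀ e, a₁ ∈ ends e → e = f)
    (hx : a₁ ≠ x) (ω : Config E) :
    cluster ends (Function.update ω f true) a₁ =
      insert a₁ (cluster ends (Function.update ω f false) x) := by
  ext v
  simp only [mem_cluster, Set.mem_insert_iff]
  have hopen : Function.update ω f true f = true := Function.update_self f true ω
  have hclosed : Function.update ω f false f = false := Function.update_self f false ω
  rw [conn_leaf_open hf hopen]
  by_cases hv : v = a₁
  · subst hv
    simp only [true_or, iff_true]
    exact conn_symm (conn_of_openAdj ⟨f, hopen, hf⟩)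
  · simp only [hv, false_or]
    -- `x ↔ v` does not see the leaf edge
    have h1 : Conn ends (Function.update ω f true) x v ↔ Conn ends ω x v :=
      conn_update_leaf_iff hf hleaf hx true (Ne.symm hx) hv
    have h0 : Conn ends (Function.update ω f false) x v ↔ Conn ends ω x v :=
      conn_update_leaf_iff hf hleaf hx false (Ne.symm hx) hv
    rw [h1, h0]

/-- The leaf is not in the cluster of `x` when the leaf edge is forced closed. -/
lemma leaf_notMem_cluster_update_false (hf : ends f = s(a₁, x)) (hleaf : ∀ e, a₁ ∈ ends e → e = f)
    (hx : a₁ ≠ x) (ω : Config E) : a₁ ∉ cluster ends (Function.update ω f false) x := by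
  intro h
  rw [mem_cluster] at h
  have hclosed : Function.update ω f false f = false := Function.update_self f false ω
  exact (Ne.symm hx) (conn_leaf_closed hf hleaf hx hclosed (conn_symm h))

/-- The root's connection events transfer: `a₁ ↔ v` with `f` forced open is `x ↔ v` with `f`
forced closed (`v ≠ a₁`). -/
lemma conn_update_true_root_iff (hf : ends f = s(a₁, x)) (hleaf : ∀ e, a₁ ∈ ends e → e = f)
    (hx : a₁ ≠ x) (ω : Config E) {v : V} (hv : v ≠ a₁) :
    Conn ends (Function.update ω f true) a₁ v ↔ Conn ends (Function.update ω f false) x v := by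
  have hopen : Function.update ω f true f = true := Function.update_self f true ω
  rw [conn_leaf_open hf hopen, conn_update_leaf_iff hf hleaf hx true (Ne.symm hx) hv,
    conn_update_leaf_iff hf hleaf hx false (Ne.symm hx) hv]

/-- Connections away from the root do not see the pin. -/
lemma conn_update_away_iff (hf : ends f = s(a₁, x)) (hleaf : ∀ e, a₁ ∈ ends e → e = f)
    (hx : a₁ ≠ x) (ω : Config E) {u v : V} (hu : u ≠ a₁) (hv : v ≠ a₁) :
    Conn ends (Function.update ω f true) u v ↔ Conn ends (Function.update ω f false) u v := by
  rw [conn_update_leaf_iff hf hleaf hx true hu hv, conn_update_leaf_iff hf hleaf hx false hu hv]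

end Transfer

section TransferProb

variable {V : Type*} {E : Type*} [Fintype E] [DecidableEq E] {R : Type*} [Field R]
  {ends : E → Sym2 V} {a₁ x : V} {f : E}

/-- Transfer of a probability: if membership in `A` with `f` forced open is membership in `A'` with
`f` forced closed, then `P_{p[f↦1]}(A) = P_{p[f↦0]}(A')`. -/
lemma prob_update_one_eq_update_zero (p : E → R) {A A' : Set (Config E)}
    (h : ∀ ω, Function.update ω f true ∈ A ↔ Function.update ω f false ∈ A') :
    prob (Function.update p f 1) A = prob (Function.update p f 0) A' := by
  rw [prob_eq_expect_indicator, prob_eq_expect_indicator, expect_update_one, expect_update_zero]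
  refine congrArg (expect p) (funext fun ω => ?_)
  by_cases hA : Function.update ω f true ∈ A
  · rw [Set.indicator_of_mem hA, Set.indicator_of_mem ((h ω).mp hA)]
    rfl
  · rw [Set.indicator_of_notMem hA, Set.indicator_of_notMem (fun hA' => hA ((h ω).mpr hA'))]

omit [Fintype E] in
/-- The cluster up-set event of the root transfers to the cluster up-set event of `x` for the
shifted up-set `𝓔' = {S ∣ insert a₁ S ∈ 𝓔}`. -/
lemma clusterInEvent_transfer (hf : ends f = s(a₁, x)) (hleaf : ∀ e, a₁ ∈ ends e → e = f)
    (hx : a₁ ≠ x) (𝓔 : Set (Set V)) (ω : Config E) :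
    Function.update ω f true ∈ clusterInEvent ends a₁ 𝓔 ↔
      Function.update ω f false ∈ clusterInEvent ends x {S | insert a₁ S ∈ 𝓔} := by
  simp only [mem_clusterInEvent, Set.mem_setOf_eq]
  rw [cluster_update_true_eq_insert hf hleaf hx ω]

omit [Fintype E] in
/-- The root's connection event transfers. -/
lemma connEvent_root_transfer (hf : ends f = s(a₁, x)) (hleaf : ∀ e, a₁ ∈ ends e → e = f)
    (hx : a₁ ≠ x) {v : V} (hv : v ≠ a₁) (ω : Config E) :
    Function.update ω f true ∈ connEvent ends a₁ v ↔
      Function.update ω f false ∈ connEvent ends x v := by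
  simp only [mem_connEvent]
  exact conn_update_true_root_iff hf hleaf hx ω hv

omit [Fintype E] in
/-- A connection event away from the root transfers to itself. -/
lemma connEvent_away_transfer (hf : ends f = s(a₁, x)) (hleaf : ∀ e, a₁ ∈ ends e → e = f)
    (hx : a₁ ≠ x) {u v : V} (hu : u ≠ a₁) (hv : v ≠ a₁) (ω : Config E) :
    Function.update ω f true ∈ connEvent ends u v ↔
      Function.update ω f false ∈ connEvent ends u v := by
  simp only [mem_connEvent]
  exact conn_update_away_iff hf hleaf hx ω hu hv

omit [Fintype E] in
/-- Transfer is compatible with intersections. -/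
lemma transfer_inter {A A' B B' : Set (Config E)}
    (hA : ∀ ω, Function.update ω f true ∈ A ↔ Function.update ω f false ∈ A')
    (hB : ∀ ω, Function.update ω f true ∈ B ↔ Function.update ω f false ∈ B') (ω : Config E) :
    Function.update ω f true ∈ A ∩ B ↔ Function.update ω f false ∈ A' ∩ B' := by
  simp only [Set.mem_inter_iff, hA ω, hB ω]

omit [Fintype E] in
/-- Transfer is compatible with complements. -/
lemma transfer_compl {A A' : Set (Config E)}
    (hA : ∀ ω, Function.update ω f true ∈ A ↔ Function.update ω f false ∈ A') (ω : Config E) :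
    Function.update ω f true ∈ Aᶜ ↔ Function.update ω f false ∈ A'ᶜ := by
  simp only [Set.mem_compl_iff, hA ω]

/-- **The root transfer of row 2′ZC at a pendant root**: the (ZC) expression with the leaf edge
pinned open and root `a₁` equals the (ZC) expression with the leaf edge pinned closed (percolation on
`G − a₁`), root `x` and the shifted up-set `𝓔' = {S ∣ insert a₁ S ∈ 𝓔}`. -/
theorem zc_pendant_transfer (hf : ends f = s(a₁, x)) (hleaf : ∀ e, a₁ ∈ ends e → e = f)
    (hx : a₁ ≠ x) (p : E → R) (𝓔 : Set (Set V)) {a₃ o : V} (h3 : a₃ ≠ a₁) (ho : o ≠ a₁) :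
    let e := connEvent ends a₁ a₃
    let L := connEvent ends a₁ o
    let γ := connEvent ends a₃ o
    let U := clusterInEvent ends a₁ 𝓔
    let e' := connEvent ends x a₃
    let L' := connEvent ends x o
    let U' := clusterInEvent ends x {S | insert a₁ S ∈ 𝓔}
    let P₁ := Function.update p f (1 : R)
    let P₀ := Function.update p f (0 : R)
    prob P₁ (eᶜ ∩ Lᶜ ∩ γᶜ) * (prob P₁ (U ∩ (e ∩ L)) - prob P₁ U * prob P₁ (e ∩ L)) -
        prob P₁ (eᶜ ∩ Lᶜ ∩ γ) * (prob P₁ (U ∩ (e ∩ Lᶜ)) - prob P₁ U * prob P₁ (e ∩ Lᶜ)) =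
      prob P₀ (e'ᶜ ∩ L'ᶜ ∩ γᶜ) * (prob P₀ (U' ∩ (e' ∩ L')) - prob P₀ U' * prob P₀ (e' ∩ L')) -
        prob P₀ (e'ᶜ ∩ L'ᶜ ∩ γ) * (prob P₀ (U' ∩ (e' ∩ L'ᶜ)) - prob P₀ U' * prob P₀ (e' ∩ L'ᶜ)) := by
  intro e L γ U e' L' U' P₁ P₀
  have te : ∀ ω, Function.update ω f true ∈ e ↔ Function.update ω f false ∈ e' :=
    fun ω => connEvent_root_transfer hf hleaf hx h3 ω
  have tL : ∀ ω, Function.update ω f true ∈ L ↔ Function.update ω f false ∈ L' :=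
    fun ω => connEvent_root_transfer hf hleaf hx ho ω
  have tγ : ∀ ω, Function.update ω f true ∈ γ ↔ Function.update ω f false ∈ γ :=
    fun ω => connEvent_away_transfer hf hleaf hx h3 ho ω
  have tU : ∀ ω, Function.update ω f true ∈ U ↔ Function.update ω f false ∈ U' :=
    fun ω => clusterInEvent_transfer hf hleaf hx 𝓔 ω
  have tec := transfer_compl (f := f) te
  have tLc := transfer_compl (f := f) tL
  have tγc := transfer_compl (f := f) tγ
  rw [prob_update_one_eq_update_zero p (transfer_inter (transfer_inter tec tLc) tγc),
    prob_update_one_eq_update_zero p (transfer_inter (transfer_inter tec tLc) tγ),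
    prob_update_one_eq_update_zero p (transfer_inter tU (transfer_inter te tL)),
    prob_update_one_eq_update_zero p (transfer_inter tU (transfer_inter te tLc)),
    prob_update_one_eq_update_zero p tU,
    prob_update_one_eq_update_zero p (transfer_inter te tL),
    prob_update_one_eq_update_zero p (transfer_inter te tLc)]

end TransferProb

section RootX

variable {V : Type*} {E : Type*} [Fintype E] [DecidableEq E] [Fintype V] [DecidableEq V]
  {R : Type*} [Field R] [LinearOrder R] [IsStrictOrderedRing R]
  {ends : E → Sym2 V} {a₁ x : V} {f : E}

omit [Fintype E] [DecidableEq E] [Fintype V] [DecidableEq V] [Field R] [LinearOrder R]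
  [IsStrictOrderedRing R] in
/-- The shifted family of an up-set is an up-set. -/
lemma isUpperSet_shift {𝓔 : Set (Set V)} (h𝓔 : IsUpperSet 𝓔) :
    IsUpperSet {S : Set V | insert a₁ S ∈ 𝓔} :=
  fun _ _ h hS => h𝓔 (Set.insert_subset_insert h) hS

/-- **Row 2′ZC at a leaf root follows from the row on `G − a₁` with root `x`**: for the leaf root
`a₁` (only edge `f = {a₁, x}`), every up-set `𝓔` with `{a₁} ∉ 𝓔` and marks `a₃, o ≠ a₁`, if the
(ZC) expression is nonnegative for percolation with `f` pinned closed, root `x` and the shifted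
up-set `𝓔' = {S ∣ insert a₁ S ∈ 𝓔}`, then it is nonnegative for `p`, root `a₁` and `𝓔`. -/
theorem zc_pendant_of_root_x (hf : ends f = s(a₁, x)) (hleaf : ∀ e, a₁ ∈ ends e → e = f)
    (hx : a₁ ≠ x) (p : E → R) (hp : IsProbVec p) {𝓔 : Set (Set V)} (h𝓔 : IsUpperSet 𝓔)
    (hE1 : ({a₁} : Set V) ∉ 𝓔) {a₃ o : V} (h3 : a₃ ≠ a₁) (ho : o ≠ a₁) :
    let e := connEvent ends a₁ a₃
    let L := connEvent ends a₁ o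
    let γ := connEvent ends a₃ o
    let U := clusterInEvent ends a₁ 𝓔
    let e' := connEvent ends x a₃
    let L' := connEvent ends x o
    let U' := clusterInEvent ends x {S | insert a₁ S ∈ 𝓔}
    let P₀ := Function.update p f (0 : R)
    0 ≤ prob P₀ (e'ᶜ ∩ L'ᶜ ∩ γᶜ) * (prob P₀ (U' ∩ (e' ∩ L')) - prob P₀ U' * prob P₀ (e' ∩ L')) -
          prob P₀ (e'ᶜ ∩ L'ᶜ ∩ γ) * (prob P₀ (U' ∩ (e' ∩ L'ᶜ)) - prob P₀ U' * prob P₀ (e' ∩ L'ᶜ)) →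
      0 ≤ prob p (eᶜ ∩ Lᶜ ∩ γᶜ) * (prob p (U ∩ (e ∩ L)) - prob p U * prob p (e ∩ L)) -
        prob p (eᶜ ∩ Lᶜ ∩ γ) * (prob p (U ∩ (e ∩ Lᶜ)) - prob p U * prob p (e ∩ Lᶜ)) := by
  simp only
  intro hZ
  have htr := zc_pendant_transfer hf hleaf hx p 𝓔 h3 ho
  simp only at htr
  have hred := zc_pendant_of_pinned_open hf hleaf hx p hp h𝓔 hE1 h3 ho
  simp only at hred
  exact hred (htr ▸ hZ)

end RootX

end ZCPendant

end Summit.Ventures.PercRepro2
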